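import Literature.Analysis.FluidPDE.PressurePoisson
import Literature.Analysis.FluidPDE.ClassicalSolutionRegion
import Literature.Analysis.FluidPDE.ClassicalSuitableRegion
import HarnessLib

/-!
# The pressure Poisson equation on an open space–time region

Analysis/FluidPDE support file (theorems only). `PressurePoisson.lean` proves the pressure Poisson
equation `Δp = −div((u·∇)u) + div f` (Tao 2011, (8)) for classical solutions on a **slab**
(`IsClassicalNSSolutionOn S`, fields smooth on `S × E`), whose pointwise ingredients
`div Δv = 0` (`divergence_laplacian_eq_zero`) and `div ∂ₜu = 0` (`divergence_deriv_time_eq_zero`)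
are stated for globally smooth, globally divergence-free fields. Local regularity theory needs
the equation for solutions that are classical on an **open region** only
(`IsClassicalNSSolutionOnRegion O`, `ClassicalSolutionRegion.lean`); this file supplies the local
(germ) forms:

* `divergence_congr_nhds` — the pointwise divergence sees only the germ;
* `divergence_laplacian_eq_zero_of_eventually` — `div Δv (x) = 0` for `v ∈ C³(E; E)` with
  `div v = 0` **near `x`** (the tree proof, with the incompressibility differentiated as a germ);
* `divergence_deriv_time_eq_zero_of_isOpen` — `div ∂ₜu = 0` at the points of an open region
  for `u` jointly smooth on the region and divergence free there;
* `laplacian_pressure_eq_of_isClassicalNSSolutionOnRegion` — the region form of Tao's (8):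
  `Δp(t)(x) = −div((u(t)·∇)u(t))(x) + div f(t)(x)` at every point of the region.

## References

* T. Tao, *Localisation and compactness properties of the Navier–Stokes global regularity
  problem*, Anal. PDE 6 (2013) = arXiv:1108.1165 (2011), (8). [Tao2011]
-/

noncomputable section

open Set Function Filter Topology InnerProductSpace
open scoped RealInnerProductSpace Laplacian ContDiff

namespace Literature.Analysis.FluidPDE

variable {E : Type*} [NormedAddCommGroup E] [InnerProductSpace ℝ E] [FiniteDimensional ℝ E]

omit [FiniteDimensional ℝ E] in
/-- **The pointwise divergence sees only the germ**: fields agreeing near `x` have the same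
divergence at `x`. [folklore] -/
theorem divergence_congr_nhds {v w : E → E} {x : E} (h : v =ᶠ[𝓝 x] w) :
    VectorCalculus.divergence v x = VectorCalculus.divergence w x := by
  simp only [VectorCalculus.divergence, h.fderiv_eq]

/-- **`div Δv (x) = 0` for `v ∈ C³(E; E)` divergence free near `x`.** The tree's
`divergence_laplacian_eq_zero` (globally divergence-free `v`), localised: with `D³v(x)` symmetric,
`div Δv(x) = Σⱼ Σᵢ ⟪bⱼ, D³v(x)(bⱼ, bᵢ, bᵢ)⟫ = Σᵢ ∂ᵢ∂ᵢ (div v)(x)`, and the incompressibility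
`Σⱼ ⟪bⱼ, Dv(·) bⱼ⟫ = 0` holds as a germ at `x`, so it may be differentiated twice there.
[folklore] -/
theorem divergence_laplacian_eq_zero_of_eventually {v : E → E} (hv : ContDiff ℝ 3 v) {x : E}
    (hdiv : ∀ᶠ y in 𝓝 x, VectorCalculus.divergence v y = 0) :
    VectorCalculus.divergence (Δ v) x = 0 := by
  set b := stdOrthonormalBasis ℝ E
  set D1 : E → E →L[ℝ] E := fderiv ℝ v with hD1_def
  set D2 : E → E →L[ℝ] E →L[ℝ] E := fderiv ℝ D1 with hD2_def
  set D3 : E → E →L[ℝ] E →L[ℝ] E →L[ℝ] E := fderiv ℝ D2 with hD3_def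
  have hD1 : ContDiff ℝ 2 D1 := hv.fderiv_right (m := 2) le_rfl
  have hD2 : ContDiff ℝ 1 D2 := hD1.fderiv_right (m := 1) le_rfl
  have hD1d : Differentiable ℝ D1 := hD1.differentiable two_ne_zero
  have hD2d : Differentiable ℝ D2 := hD2.differentiable one_ne_zero
  -- Schwarz for `v` (everywhere) and for `Dv` (at `x`)
  have h23 : minSmoothness ℝ 2 ≤ (3 : ℕ∞ω) := by
    rw [minSmoothness_of_isRCLikeNormedField]
    exact_mod_cast (show (2 : ℕ) ≤ 3 by norm_num)
  have h22 : minSmoothness ℝ 2 ≤ (2 : ℕ∞ω) := by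
    rw [minSmoothness_of_isRCLikeNormedField]
  have hS2 : ∀ y a c, D2 y a c = D2 y c a := fun y a c =>
    (hv.contDiffAt.isSymmSndFDerivAt h23).eq a c
  have hS3 : ∀ a c, D3 x a c = D3 x c a := fun a c =>
    (hD1.contDiffAt.isSymmSndFDerivAt h22).eq a c
  have hS3' : ∀ a c d, D3 x a c d = D3 x a d c := fun a c d => by
    have h1 : (fun y => D2 y c d) = fun y => D2 y d c := funext fun y => hS2 y c d
    have h2 : ∀ c d, fderiv ℝ (fun y => D2 y c d) x a = D3 x a c d := fun c d => by
      have hcd : DifferentiableAt ℝ (fun y => D2 y c) x := (hD2d x).clm_apply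
        (differentiableAt_const _)
      rw [fderiv_apply_const_apply hcd, fderiv_apply_const_apply (hD2d x)]
    rw [← h2 c d, h1, h2 d c]
  -- `Δ v = Σᵢ D²v(·)(bᵢ, bᵢ)` and its derivative
  have hΔ : (Δ v) = fun y => ∑ i, D2 y (b i) (b i) := by
    funext y
    rw [laplacian_eq_sum_fderiv_fderiv b (hv.of_le (by norm_num)) y]
    exact Finset.sum_congr rfl fun i _ => fderiv_apply_const_apply (hD1d y) _ _
  have hfd : ∀ a, fderiv ℝ (Δ v) x a = ∑ i, D3 x a (b i) (b i) := fun a => by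
    have hdi : ∀ i, DifferentiableAt ℝ (fun y => D2 y (b i)) x := fun i =>
      (hD2d x).clm_apply (differentiableAt_const _)
    rw [hΔ, fderiv_fun_sum fun i _ => (hdi i).clm_apply (differentiableAt_const _),
      _root_.FunLike.coe_sum, Finset.sum_apply]
    refine Finset.sum_congr rfl fun i _ => ?_
    rw [fderiv_apply_const_apply (hdi i), fderiv_apply_const_apply (hD2d x)]
  -- twice-differentiated incompressibility, as germs at `x`
  have hdiv1 : (fun y => ∑ j, ⟪b j, D1 y (b j)⟫) =ᶠ[𝓝 x] fun _ => (0 : ℝ) := by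
    filter_upwards [hdiv] with y hy
    rw [← divergence_eq_sum_inner_fderiv b v y]
    exact hy
  have hdiv2 : ∀ a, (fun y => ∑ j, ⟪b j, D2 y a (b j)⟫) =ᶠ[𝓝 x] fun _ => (0 : ℝ) := fun a => by
    have h1 : (fderiv ℝ fun y => ∑ j, ⟪b j, D1 y (b j)⟫) =ᶠ[𝓝 x]
        fderiv ℝ (fun _ : E => (0 : ℝ)) := hdiv1.fderiv
    filter_upwards [h1] with y hy
    rw [← fderiv_sum_inner_apply_apply b (hD1d y) a, hy]
    simp
  have hdiv3 : ∀ a, ∑ j, ⟪b j, D3 x a a (b j)⟫ = 0 := fun a => by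
    have hda : DifferentiableAt ℝ (fun y => D2 y a) x := (hD2d x).clm_apply
      (differentiableAt_const _)
    have := fderiv_sum_inner_apply_apply b hda a
    rw [(hdiv2 a).fderiv_eq, fderiv_apply_const_apply (hD2d x)] at this
    simpa using this.symm
  -- assemble
  rw [divergence_eq_sum_inner_fderiv b]
  simp_rw [hfd, inner_sum]
  rw [Finset.sum_comm]
  refine Finset.sum_eq_zero fun i _ => ?_
  have : ∀ j, D3 x (b j) (b i) (b i) = D3 x (b i) (b i) (b j) := fun j => by
    rw [hS3 (b j) (b i)]
    exact hS3' _ _ _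
  simp_rw [this]
  exact hdiv3 (b i)


/-! ### Germ representatives on a finite-dimensional space -/

/-- **A function `Cⁿ` on an open set agrees near each of its points with a globally `Cⁿ`
function** (bump `≡ 1` near the point, supported in the set) — the tree's
`ContDiffOn.exists_contDiff_eventuallyEq` (`LocalAffineChainRules`, inner product domains) on a
general finite-dimensional normed domain (here `ℝ × E`). [folklore] -/
theorem ContDiffOn.exists_contDiff_eventuallyEq_of_finiteDimensional {X F : Type*}
    [NormedAddCommGroup X] [NormedSpace ℝ X] [FiniteDimensional ℝ X] [NormedAddCommGroup F]
    [NormedSpace ℝ F] {n : ℕ∞} {f : X → F} {S : Set X} (hf : ContDiffOn ℝ n f S) (hS : IsOpen S)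
    {x : X} (hx : x ∈ S) : ∃ g : X → F, ContDiff ℝ n g ∧ g =ᶠ[𝓝 x] f := by
  obtain ⟨r, hr, hrS⟩ := Metric.isOpen_iff.1 hS x hx
  let χ : ContDiffBump x := ⟨r / 4, r / 2, by positivity, by linarith⟩
  have hχS : tsupport χ ⊆ S := by
    rw [χ.tsupport_eq]
    exact (Metric.closedBall_subset_ball (by show r / 2 < r; linarith)).trans hrS
  refine ⟨fun z => χ z • f z, ?_, ?_⟩
  · rw [contDiff_iff_contDiffAt]
    intro z
    by_cases hz : z ∈ S
    · exact χ.contDiff.contDiffAt.smul (hf.contDiffAt (hS.mem_nhds hz))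
    · have hz' : z ∉ tsupport χ := fun h => hz (hχS h)
      have h0 : (fun w => χ w • f w) =ᶠ[𝓝 z] fun _ => 0 := by
        filter_upwards [notMem_tsupport_iff_eventuallyEq.1 hz'] with w hw
        simp [hw]
      exact contDiffAt_const.congr_of_eventuallyEq h0
  · filter_upwards [Metric.closedBall_mem_nhds x (by positivity : 0 < r / 4)] with z hz
    rw [χ.one_of_mem_closedBall hz, one_smul]

/-! ### `div ∂ₜ u = 0` at the points of an open region -/

/-- **`div ∂ₜu = ∂ₜ div u = 0` on an open region.** For a field `u` jointly smooth on an open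
space–time region `O` and divergence free at the points of `O`, the two-sided time derivative
`y ↦ ∂ₜu(t, y)` is divergence free at every `(t, x) ∈ O` — region form of the tree's
`divergence_deriv_time_eq_zero` (slab): pass to a globally smooth representative `w` of the germ
of `u` at `(t, x)`, exchange `∂ₜ` and `D` for `w` (`IsSmoothSpaceTimeOn.hasDerivAt_fderiv_slice_clm`),
and use that `div w(s, ·)(x) = div u(s, ·)(x) = 0` for `s` near `t`. [folklore] -/
theorem divergence_deriv_time_eq_zero_of_isOpen {O : Set (ℝ × E)} (hO : IsOpen O)
    {u : ℝ → E → E} (hu : ContDiffOn ℝ ∞ (uncurry u) O)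
    (hdiv : ∀ z ∈ O, VectorCalculus.divergence (u z.1) z.2 = 0) {t : ℝ} {x : E}
    (htx : (t, x) ∈ O) :
    VectorCalculus.divergence (fun y => deriv (fun s => u s y) t) x = 0 := by
  set b := stdOrthonormalBasis ℝ E
  -- a globally smooth representative of the germ of `u` at `(t, x)`
  obtain ⟨g, hg, hgu⟩ := ContDiffOn.exists_contDiff_eventuallyEq_of_finiteDimensional hu hO htx
  set w : ℝ → E → E := curry g with hw_def
  have hgw : uncurry w = g := uncurry_curry g
  have hws : IsSmoothSpaceTimeOn univ w := by
    show ContDiffOn ℝ ∞ (uncurry w) (univ ×ˢ univ)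
    rw [hgw]; exact hg.contDiffOn
  -- germs at nearby points
  have hnear : ∀ᶠ z in 𝓝 (t, x), uncurry w =ᶠ[𝓝 z] uncurry u := by
    rw [hgw]; exact eventually_eventuallyEq_nhds.2 hgu
  have hO' : ∀ᶠ z in 𝓝 (t, x), z ∈ O := hO.mem_nhds htx
  -- exchange of `∂ₜ` and `D` for `w`
  set Φ' := fderiv ℝ (fun y => deriv (fun s => w s y) t) x with hΦ'
  have hΦ : HasDerivAt (fun s => fderiv ℝ (w s) x) Φ' t :=
    hws.hasDerivAt_fderiv_slice_clm isOpen_univ (mem_univ t) x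
  have hj : ∀ j, HasDerivAt (fun s => ⟪b j, fderiv ℝ (w s) x (b j)⟫) ⟪b j, Φ' (b j)⟫ t := by
    intro j
    have h1 : HasDerivAt (fun s => fderiv ℝ (w s) x (b j)) (Φ' (b j)) t := by
      simpa using hΦ.clm_apply (hasDerivAt_const t (b j))
    simpa using (hasDerivAt_const t (b j)).inner ℝ h1
  have hsum : HasDerivAt (fun s => ∑ j, ⟪b j, fderiv ℝ (w s) x (b j)⟫) (∑ j, ⟪b j, Φ' (b j)⟫) t :=
    HasDerivAt.fun_sum fun j _ => hj j
  -- `div w(s, ·)(x) = div u(s, ·)(x) = 0` for `s` near `t`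
  have hzero : (fun s => ∑ j, ⟪b j, fderiv ℝ (w s) x (b j)⟫) =ᶠ[𝓝 t] fun _ => (0 : ℝ) := by
    have h1 : ∀ᶠ s in 𝓝 t, uncurry w =ᶠ[𝓝 (s, x)] uncurry u :=
      (Continuous.prodMk_left x).continuousAt.eventually hnear
    have h2 : ∀ᶠ s in 𝓝 t, (s, x) ∈ O := (Continuous.prodMk_left x).continuousAt.eventually hO'
    filter_upwards [h1, h2] with s hs hsO
    rw [← divergence_eq_sum_inner_fderiv b (w s) x, VectorCalculus.divergence,
      fderiv_slice_congr_of_eventuallyEq hs]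
    exact hdiv (s, x) hsO
  have h0 : HasDerivAt (fun _ : ℝ => (0 : ℝ)) (∑ j, ⟪b j, Φ' (b j)⟫) t :=
    hsum.congr_of_eventuallyEq hzero.symm
  have hdivw : VectorCalculus.divergence (fun y => deriv (fun s => w s y) t) x = 0 := by
    rw [divergence_eq_sum_inner_fderiv b]
    exact h0.unique (hasDerivAt_const t 0)
  -- back to `u`: the time-derivative slices agree near `x`
  have hslice : (fun y => deriv (fun s => w s y) t) =ᶠ[𝓝 x] fun y => deriv (fun s => u s y) t := by
    have h1 : ∀ᶠ y in 𝓝 x, uncurry w =ᶠ[𝓝 (t, y)] uncurry u :=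
      (Continuous.prodMk_right t).continuousAt.eventually hnear
    filter_upwards [h1] with y hy
    exact (eventuallyEq_timeLine_of_eventuallyEq_uncurry hy).deriv_eq
  rw [← divergence_congr_nhds hslice]
  exact hdivw


/-! ### The pressure Poisson equation on an open region -/

/-- The two-sided time-derivative slice `y ↦ ∂ₜu(t, y)` of a field jointly smooth on an open
region is differentiable at the points of the region (it agrees near `x` with the smooth field
`y ↦ D g(t, y)(1, 0)` of a global representative `g` of the germ). [folklore] -/
theorem differentiableAt_deriv_time_of_isOpen {F : Type*} [NormedAddCommGroup F]
    [NormedSpace ℝ F] {O : Set (ℝ × E)} (hO : IsOpen O) {u : ℝ → E → F}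
    (hu : ContDiffOn ℝ ∞ (uncurry u) O) {t : ℝ} {x : E} (htx : (t, x) ∈ O) :
    DifferentiableAt ℝ (fun y => deriv (fun s => u s y) t) x := by
  obtain ⟨g, hg, hgu⟩ := ContDiffOn.exists_contDiff_eventuallyEq_of_finiteDimensional hu hO htx
  have hnear : ∀ᶠ z in 𝓝 (t, x), g =ᶠ[𝓝 z] uncurry u := eventually_eventuallyEq_nhds.2 hgu
  have h1 : ∀ᶠ y in 𝓝 x, g =ᶠ[𝓝 (t, y)] uncurry u :=
    (Continuous.prodMk_right t).continuousAt.eventually hnear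
  have hev : (fun y => fderiv ℝ g (t, y) ((1 : ℝ), (0 : E))) =ᶠ[𝓝 x]
      fun y => deriv (fun s => u s y) t := by
    filter_upwards [h1] with y hy
    have hy' : uncurry (curry g) =ᶠ[𝓝 (t, y)] uncurry u := by
      simpa [Function.uncurry_curry] using hy
    have hcurry : (fun s => curry g s y) =ᶠ[𝓝 t] fun s => u s y :=
      eventuallyEq_timeLine_of_eventuallyEq_uncurry hy'
    rw [← hcurry.deriv_eq]
    have hgd : HasFDerivAt (uncurry (curry g)) (fderiv ℝ g (t, y)) (t, y) := by
      rw [Function.uncurry_curry]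
      exact ((hg.differentiable (by simp)) (t, y)).hasFDerivAt
    exact ((hasDerivAt_timeLine hgd).deriv).symm
  refine DifferentiableAt.congr_of_eventuallyEq ?_ hev.symm
  have hD : Differentiable ℝ (fderiv ℝ g) :=
    (contDiff_infty_iff_fderiv.1 hg).2.differentiable (by simp)
  have hc : Differentiable ℝ fun y : E => ((t, y) : ℝ × E) :=
    (contDiff_prodMk_right t).differentiable one_ne_zero
  exact ((hD.comp hc) x).clm_apply (differentiableAt_const _)

/-- **The pressure Poisson equation on an open region (Tao 2011, (8)).** For a classical solution
`(u, p)` of Navier–Stokes on an open space–time region `O` (`IsClassicalNSSolutionOnRegion`, any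
viscosity, force `f ∈ C¹(O)`) and every `(t, x) ∈ O`,
`Δp(t)(x) = −div((u(t)·∇)u(t))(x) + div f(t)(x)`: the divergence of the momentum equation,
which holds near `x` at time `t`, with `div ∂ₜu = 0` (`divergence_deriv_time_eq_zero_of_isOpen`),
`div Δu = 0` (`divergence_laplacian_eq_zero_of_eventually`) and `div ∇p = Δp`, all computed on
globally smooth representatives of the germs at `x`. [cite: Tao2011, (8)] -/
theorem laplacian_pressure_eq_of_isClassicalNSSolutionOnRegion {O : Set (ℝ × E)} (hO : IsOpen O)
    {ν : ℝ} {f u : ℝ → E → E} {p : ℝ → E → ℝ} (h : IsClassicalNSSolutionOnRegion O ν f u p)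
    (hf : ContDiffOn ℝ 1 (uncurry f) O) {t : ℝ} {x : E} (htx : (t, x) ∈ O) :
    Δ (p t) x = -VectorCalculus.divergence (convect (u t) (u t)) x +
      VectorCalculus.divergence (f t) x := by
  have hU : IsOpen (spaceSection O t) := isOpen_spaceSection hO t
  have hxU : x ∈ spaceSection O t := htx
  -- globally smooth representatives of the germs at `x` of `u(t)`, `p(t)`, `f(t)`
  obtain ⟨V, hV, hVu⟩ := ContDiffOn.exists_contDiff_eventuallyEq_of_finiteDimensional
    (h.contDiffOn_velocity t) hU hxU
  obtain ⟨P, hP, hPp⟩ := ContDiffOn.exists_contDiff_eventuallyEq_of_finiteDimensional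
    (h.contDiffOn_pressure t) hU hxU
  obtain ⟨Fr, hFr, hFf⟩ := ContDiffOn.exists_contDiff_eventuallyEq_of_finiteDimensional
    (contDiffOn_spaceSection hf t) hU hxU
  have hVu' : ∀ᶠ y in 𝓝 x, V =ᶠ[𝓝 y] u t := eventually_eventuallyEq_nhds.2 hVu
  have hPp' : ∀ᶠ y in 𝓝 x, P =ᶠ[𝓝 y] p t := eventually_eventuallyEq_nhds.2 hPp
  have hUx : ∀ᶠ y in 𝓝 x, y ∈ spaceSection O t := hU.mem_nhds hxU
  -- the time-derivative slice
  set d : E → E := fun y => deriv (fun s => u s y) t with hd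
  have hdd : DifferentiableAt ℝ d x := differentiableAt_deriv_time_of_isOpen hO h.smooth_velocity htx
  have hdivd : VectorCalculus.divergence d x = 0 :=
    divergence_deriv_time_eq_zero_of_isOpen hO h.smooth_velocity (fun z hz => h.divFree z.1 z.2 hz) htx
  -- regularity of the representatives
  have hV3 : ContDiff ℝ 3 V := contDiff_infty.1 hV 3
  have hVd : Differentiable ℝ V := hV.differentiable (by simp)
  have hDVd : Differentiable ℝ (fderiv ℝ V) :=
    (contDiff_infty_iff_fderiv.1 hV).2.differentiable (by simp)
  have hΔVd : Differentiable ℝ (Δ V) := differentiable_laplacian hV3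
  have hcVd : Differentiable ℝ (convect V V) := by
    have : convect V V = fun y => fderiv ℝ V y (V y) := rfl
    rw [this]; exact hDVd.clm_apply hVd
  have hFrd : Differentiable ℝ Fr := hFr.differentiable one_ne_zero
  have hP2 : ContDiff ℝ 2 P := contDiff_infty.1 hP 2
  -- `div ΔV (x) = 0`: `V` is divergence free near `x`
  have hdivΔ : VectorCalculus.divergence (Δ V) x = 0 := by
    refine divergence_laplacian_eq_zero_of_eventually hV3 ?_
    filter_upwards [hVu', hUx] with y hy hyU
    rw [divergence_congr_nhds hy]
    exact h.divFree t y hyU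
  -- the momentum equation near `x`, on the representatives
  have hmom : gradient P =ᶠ[𝓝 x] fun y => ν • (Δ V) y + Fr y - d y - convect V V y := by
    filter_upwards [hVu', hPp', hFf, hUx] with y hyV hyP hyF hyU
    have hm := h.momentum_deriv hO (show (t, y) ∈ O from hyU)
    have e1 : gradient P y = gradient (p t) y := by
      rw [gradient, gradient, hyP.fderiv_eq]
    have e2 : (Δ V) y = (Δ (u t)) y := (InnerProductSpace.laplacian_congr_nhds hyV).eq_of_nhds
    have e3 : convect V V y = convect (u t) (u t) y := by
      simp only [convect, hyV.fderiv_eq, hyV.eq_of_nhds]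
    rw [e1, e2, e3, hyF]
    change d y + convect (u t) (u t) y = ν • (Δ (u t)) y - gradient (p t) y + f t y at hm
    rw [← sub_eq_zero] at hm ⊢
    rw [← hm]
    abel
  -- take the divergence at `x`
  have d1 : DifferentiableAt ℝ (fun y => ν • (Δ V) y) x := (hΔVd x).const_smul ν
  have d2 : DifferentiableAt ℝ (fun y => ν • (Δ V) y + Fr y) x := d1.add (hFrd x)
  have d3 : DifferentiableAt ℝ (fun y => ν • (Δ V) y + Fr y - d y) x := d2.sub hdd
  have hL : Δ (p t) x = VectorCalculus.divergence (gradient P) x := by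
    rw [divergence_gradient hP2, (InnerProductSpace.laplacian_congr_nhds hPp).eq_of_nhds]
  have hR1 : VectorCalculus.divergence (convect V V) x =
      VectorCalculus.divergence (convect (u t) (u t)) x := by
    refine divergence_congr_nhds ?_
    filter_upwards [hVu'] with y hyV
    simp only [convect, hyV.fderiv_eq, hyV.eq_of_nhds]
  have hR2 : VectorCalculus.divergence Fr x = VectorCalculus.divergence (f t) x :=
    divergence_congr_nhds hFf
  rw [hL, divergence_congr_nhds hmom, divergence_sub_apply d3 (hcVd x),
    divergence_sub_apply d2 hdd, divergence_add_apply d1 (hFrd x),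
    divergence_const_smul_apply (hΔVd x), hdivd, hdivΔ, hR1, hR2]
  ring

end Literature.Analysis.FluidPDE

end
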